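import Summits.Langlands.Langlands.Statement
import Summits.Langlands.Langlands.Theorems.IrreducibilityBySelfDualityReciprocityUpToIrreducibilityCorrespondsConj
import HarnessLib

/-!
# Stub `stub_avatarConjugacy` of the registered line `birth_EisensteinDegreeShift`
# (crux stmt-Langlands-18372 `EisensteinDegreeShift.SectorComplement`)

Support file (closes nothing; `--supports stmt-Langlands-18372`).  The registered skeleton
`Cruxes/SectorComplement/Lines/birth_EisensteinDegreeShift.lean` (sha 21d10751…, 6 stubs, composition
`SectorComplement_of` kernel-checked) has as its sixth stub U — uniqueness of the irreducible Satake
avatar of a cuspidal `π` up to `GL_n(ℚ̄_ℓ)`-conjugacy — whose text is VERBATIM the support item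
`PrimeSwitchSplit.AvatarConjugacy` (stmt-Langlands-17844).  It is proved here, with exactly the registered
signature, in one line from the landed change-of-frame theorem
`ReciprocityUpToIrreducibility.isConjugate_of_satakeFrobCompatibleAt` (p119850: uniqueness of Satake
parameters, Chebotarev density, Brauer–Nesbitt, irreducibility transfer, equivalent framed
representations are conjugate — Deligne–Serre 1974, Lemme 3.2).

Design note (import hygiene).  This file deliberately does NOT restate the theorem at the type
`Summit.Langlands.Langlands.Theses.PrimeSwitchSplit.AvatarConjugacy`: item stmt-Langlands-17844 carries a
planner cone guardrail (closing it from a module whose import cone still reaches `TunnellLemma` /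
`JacquetLanglandsParts` — as `…CorrespondsConj` does until refactor wi-37501 lands — would re-import that
cone into route PrimeSwitchSplit's file through the `_holds` link).  A `--supports` file adds no link to
any route file, so the cone stays where it already is.

What is NOT here: stubs 1–5 of the line (`X → B_w`, W⁺, P, L∤R, RD) — each is summit-scale and is,
verbatim, an open item of route PrimeSwitchSplit (17414 granted X, 17415, 17534, 18084, 17930); see
`Cruxes/SectorComplement/Disproof.lean` PART IV §E6.

References: P. Deligne, J.-P. Serre, *Formes modulaires de poids 1*, ASENS 7 (1974), Lemme 3.2;
J.-P. Serre, *Abelian ℓ-adic representations and elliptic curves* (1968), Ch. I §2.3.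
-/

noncomputable section

-- `Summit.Langlands.Langlands.…` (summit = sub-problem name, D-0017 layout) trips `dupNamespace`.
set_option linter.dupNamespace false

open Filter IsDedekindDomain
open Literature.NumberTheory.Automorphic Literature.NumberTheory.GaloisRepresentations
open Summit.Langlands

namespace Summit.Langlands.Langlands.Theorems.EisensteinDegreeShiftSectorComplement

/-- **Registered stub `stub_avatarConjugacy` (U) of line `birth_EisensteinDegreeShift`, verbatim**:
for a cuspidal `π` of `GL_n(𝔸_K)`, `ι : ℚ̄_ℓ ≃ ℂ` and framed `ℓ`-adic `ρ₀`, `ρ`, both Satake–Frobenius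
compatible with `(π, ι)` at almost all finite places, `ρ₀` irreducible ⟹ `ρ` is `GL_n(ℚ̄_ℓ)`-conjugate
to `ρ₀`.  (Text = `PrimeSwitchSplit.AvatarConjugacy`, stmt-Langlands-17844.)  Proof: the landed
`ReciprocityUpToIrreducibility.isConjugate_of_satakeFrobCompatibleAt` at `π.1`.
[cite: DeligneSerreASENS1974, Lemme 3.2] -/
theorem stub_avatarConjugacy :
    ∀ (K : Type) [Field K] [NumberField K] (n : ℕ) (hcpt : Literature.NumberTheory.Automorphic.isCompact_glFiniteIntegralLevel n K) (π : Literature.NumberTheory.Automorphic.CuspidalAutomorphicRepData n K hcpt) (ℓ : ℕ) [Fact ℓ.Prime] (ι : PadicAlgCl ℓ ≃+* ℂ) (ρ₀ ρ : Literature.NumberTheory.GaloisRepresentations.FramedGaloisRep K (PadicAlgCl ℓ) n), ρ₀.toGaloisRep.IsIrreducible → (∀ᶠ v : IsDedekindDomain.HeightOneSpectrum (NumberField.RingOfIntegers K) in Filter.cofinite, Summit.Langlands.SatakeFrobCompatibleAt ι π.1 ρ₀ v) → (∀ᶠ v : IsDedekindDomain.HeightOneSpectrum (NumberField.RingOfIntegers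 K) in Filter.cofinite, Summit.Langlands.SatakeFrobCompatibleAt ι π.1 ρ v) → Summit.Langlands.IsConjugate ρ₀ ρ :=
  fun _K _ _ _n _hcpt π _ℓ _ ι _ρ₀ _ρ h₀ hρ₀ hρ =>
    ReciprocityUpToIrreducibility.isConjugate_of_satakeFrobCompatibleAt π.1 ι h₀ hρ₀ hρ

end Summit.Langlands.Langlands.Theorems.EisensteinDegreeShiftSectorComplement

end
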